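import Summits.Ventures.HSemireg.WedgeHankelBoxKernel
import Summits.Ventures.HSemireg.WedgeHankelPointKernel
import Summits.Ventures.HSemireg.WedgeHankelRankOne

/-!
# Venture HSemireg — THE DEGENERATE CLASSES ARE THE PURE ONES: a class killed by a non-zero `1`-form is `A·exp(λΘ)`, the point, or zero,
# and its kernel in every degree is the ideal of its frame

HONEST FRAMING. Part of the Lean index of the computation cell `pub-hsemireg` (seat p10 gen 14, Sunday typer «UNIFORM-IN-n»).
Finite-dimensional EXTERIOR ALGEBRA over a field and ranks of HANKEL MATRICES ONLY: no variety, no cohomology theory, no sheaf, no Ext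
group and no semiregularity map is constructed here; nothing here says that HC / HC_CM / HC_AV holds; no Literature fact is declared or
used.  Custodian versions cited: theory/FORMULA-N.md PART A §2.6 THEOREM H and its KRONECKER DICTIONARY («ρ = 1 pure (line bundle / 𝒪 / pt)»);
STRUCTURE.md v1.0-SIGNED 9b196a05977dd067 §1.1 C15.  The dictionary is QUOTED, never asserted.

WHAT IS KEYED.  C3 (`WedgeHankelBoxKernel.Kr_w_one_eq_bot_iff`): no `1`-form kills `w_m(q)` ⟺ `rank H_1(q) = 2`; C6/C7: the kernels of the pure class
`A·Π(x_a + λy_a)` and of the point `c·E_{y-block}` are the frame ideals `F_λ(k)`, `F_∞(k)`; D7 (`WedgeHankelRankOne`): `rank H_1(q) ≤ 1 ⟺ q` is an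
exponential or the point on `{0, …, m}`.  THIS FILE assembles the converse gen 13 left open:
* §1 **`Kr_w_one_ne_bot_iff`: `Kr(univ, w_m(q), 1) ≠ 0 ⟺ rank H_1(q) ≤ 1`** (`m ≥ 1`; the Hankel rank is `≤ 2`).
* §2 **THE DEGENERATE TRICHOTOMY `degenerate_trichotomy`**: if some non-zero `1`-form kills `w_m(q)` (`m ≥ 1`) then EITHER `w_m(q) = 0`, OR
  `w_m(q) = A·u^λ_0 ∧ ⋯ ∧ u^λ_{m−1}` with `A ≠ 0` (a pure class: `q_j = Aλ^j` on `{0,…,m}`) and `Kr(univ, w_m(q), k) = F_λ(k)` for every `k ≥ 1`, OR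
  `w_m(q) = q_m·E_{y-block}` with `q_m ≠ 0` (the point) and `Kr(univ, w_m(q), k) = F_∞(k)` for every `k ≥ 1`.
* §3 consequences: a degenerate non-zero class is killed by exactly `m` independent `1`-forms (`finrank_Kr_w_one_of_degenerate`:
  `dim Kr¹ ∈ {0, m, 2m}`), and its kernel in degree `k ≥ 1` has dimension `C(2m,k) − C(m,k)`.
Namespace `Summit.Ventures.HSemireg.Wedge.HankelRankOne` (continued); new names only.
-/

open Module

namespace Summit.Ventures.HSemireg.Wedge.HankelRankOne

open Summit.Ventures.HSemireg.Wedge Summit.Ventures.HSemireg.Wedge.Kunneth Summit.Ventures.HSemireg.Wedge.KunnethKernel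
  Summit.Ventures.HSemireg.Wedge.HankelFaces Summit.Ventures.HSemireg.Wedge.HankelBox Summit.Ventures.HSemireg.Wedge.HankelPureKernel
  Summit.Ventures.HSemireg.Wedge.HankelBoxKernel

variable (K : Type*) [Field K] (m : ℕ)

/-! ## §1. Degenerate ⟺ Hankel rank at most one -/

/-- **`Kr(univ, w_m(q), 1) ≠ 0 ⟺ rank H_1(q) ≤ 1`** (`m ≥ 1`): C3's criterion, the Hankel rank being at most `2`. -/
theorem Kr_w_one_ne_bot_iff (hm : 1 ≤ m) (q : ℕ → K) :
    Kr K Finset.univ (Hankel.w K m m q) 1 ≠ ⊥ ↔ (Hankel.hankel1 K m 1 q).rank ≤ 1 := by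
  rw [Ne, Kr_w_one_eq_bot_iff K hm q]
  have h2 : (Hankel.hankel1 K m 1 q).rank ≤ 1 + 1 := Matrix.rank_le_height _
  omega

/-- so **a class killed by a non-zero `1`-form is, on `{0, …, m}`, an exponential or the point** (`m ≥ 1`). -/
theorem expSeq_or_point_of_Kr_one_ne_bot (hm : 1 ≤ m) {q : ℕ → K} (h : Kr K Finset.univ (Hankel.w K m m q) 1 ≠ ⊥) :
    (∃ A lam : K, ∀ j ≤ m, q j = A * lam ^ j) ∨ (∀ j < m, q j = 0) :=
  (rank_hankel1_one_le_one_iff K hm q).mp ((Kr_w_one_ne_bot_iff K m hm q).mp h)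

/-! ## §2. The degenerate trichotomy -/

/-- the kernel spaces of the zero class are everything: `Kr(D, 0, a) = Hom(D, a)`. -/
lemma Kr_zero_eq_Hom {I : Type*} [LinearOrder I] [Fintype I] (D : Finset I) (a : ℕ) : Kr K D (0 : HT K I) a = Hom K I D a := by
  apply le_antisymm (Kr_le_Hom K D 0 a)
  intro θ hθ
  exact mem_Kr.mpr ⟨hθ, mul_zero θ⟩

/-- **THE DEGENERATE TRICHOTOMY** (`m ≥ 1`).  If some non-zero `1`-form kills `w_m(q)`, then EITHER
(i) `w_m(q) = 0` (and every form kills it), OR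
(ii) `w_m(q) = A · u^λ_0 ∧ ⋯ ∧ u^λ_{m−1}` with `A ≠ 0` — a PURE class, `q_j = Aλ^j` on `{0,…,m}` — and `Kr(univ, w_m(q), k) = F_λ(k)` for every `k ≥ 1`, OR
(iii) `w_m(q) = q_m · E_{y-block}` with `q_m ≠ 0` — the POINT — and `Kr(univ, w_m(q), k) = F_∞(k) = Σ_a y_a ∧ Hom(univ, k−1)` for every `k ≥ 1`. -/
theorem degenerate_trichotomy (hm : 1 ≤ m) {q : ℕ → K} (h : Kr K Finset.univ (Hankel.w K m m q) 1 ≠ ⊥) :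
    Hankel.w K m m q = 0 ∨
    (∃ A lam : K, A ≠ 0 ∧ (∀ j ≤ m, q j = A * lam ^ j) ∧ Hankel.w K m m q = A • uprod K m lam m ∧
        ∀ k, 1 ≤ k → Kr K Finset.univ (Hankel.w K m m q) k = frameIdeal K m (uvec K m lam) k) ∨
    (q m ≠ 0 ∧ (∀ j < m, q j = 0) ∧ Hankel.w K m m q = q m • B K (Hankel.In m) (WedgePair.Yset m) ∧
        ∀ k, 1 ≤ k → Kr K Finset.univ (Hankel.w K m m q) k = frameIdeal K m (Hankel.Y K m) k) := by
  rcases expSeq_or_point_of_Kr_one_ne_bot K m hm h with ⟨A, lam, hq⟩ | hq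
  · have hw : Hankel.w K m m q = Hankel.w K m m (expSeq K A lam) := w_eq_w_expSeq K hq
    by_cases hA : A = 0
    · left
      rw [hw, w_expSeq, hA, zero_smul]
    · right; left
      refine ⟨A, lam, hA, hq, by rw [hw, w_expSeq], fun k hk => ?_⟩
      rw [hw, Kr_w_expSeq K m hA lam hk]
  · have hw : Hankel.w K m m q = Hankel.w K m m (ppSeq K m 0 (q m)) := w_eq_w_ppSeq K hm hq
    by_cases hqm : q m = 0
    · left
      rw [hw, w_ppSeq_zero K m hm, hqm, zero_smul]
    · right; right
      refine ⟨hqm, hq, by rw [hw, w_ppSeq_zero K m hm], fun k hk => ?_⟩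
      rw [hw, Kr_w_point K m hm hqm hk]

/-- the class-level dichotomy without the sequence data: **a degenerate class is zero, pure, or the point**. -/
theorem w_eq_of_Kr_one_ne_bot (hm : 1 ≤ m) {q : ℕ → K} (h : Kr K Finset.univ (Hankel.w K m m q) 1 ≠ ⊥) :
    Hankel.w K m m q = 0 ∨ (∃ A lam : K, A ≠ 0 ∧ Hankel.w K m m q = A • uprod K m lam m) ∨
      (∃ c : K, c ≠ 0 ∧ Hankel.w K m m q = c • B K (Hankel.In m) (WedgePair.Yset m)) := by
  rcases degenerate_trichotomy K m hm h with h0 | ⟨A, lam, hA, -, hw, -⟩ | ⟨hc, -, hw, -⟩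
  · exact Or.inl h0
  · exact Or.inr (Or.inl ⟨A, lam, hA, hw⟩)
  · exact Or.inr (Or.inr ⟨q m, hc, hw⟩)

/-! ## §3. Consequences -/

/-- `dim Hom(univ, k) = C(2m, k)` on th-7's model (private copy). -/
private lemma finrank_Hom_univ (k : ℕ) : finrank K (Hom K (Hankel.In m) Finset.univ k) = (m + m).choose k := by
  rw [Hom_univ_eq_exteriorPower, exteriorPower.finrank_eq, finrank_fintype_fun_eq_card, Fintype.card_fin]

/-- **the kernel of a NON-ZERO degenerate class in every degree `k ≥ 1` has dimension `C(2m,k) − C(m,k)`** (pure or point alike). -/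
theorem finrank_Kr_w_of_degenerate (hm : 1 ≤ m) {q : ℕ → K} (h : Kr K Finset.univ (Hankel.w K m m q) 1 ≠ ⊥) (hw : Hankel.w K m m q ≠ 0)
    {k : ℕ} (hk : 1 ≤ k) : finrank K (Kr K Finset.univ (Hankel.w K m m q) k) = (m + m).choose k - m.choose k := by
  rcases degenerate_trichotomy K m hm h with h0 | ⟨A, lam, -, -, -, hKr⟩ | ⟨hc, -, hw', hKr⟩
  · exact absurd h0 hw
  · rw [hKr k hk, finrank_frameIdeal_uvec K m lam hk]
  · rw [hKr k hk, ← Kr_w_point K m hm hc hk, finrank_Kr_w_point K m hm hc k]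

/-- in degree `1`: **a non-zero degenerate class is killed by EXACTLY `m` independent `1`-forms** (its frame), the zero class by all `2m`; so
`dim Kr(univ, w_m(q), 1) ∈ {0, m, 2m}` for every class (`m ≥ 1`). -/
theorem finrank_Kr_w_one_trichotomy (hm : 1 ≤ m) (q : ℕ → K) :
    finrank K (Kr K Finset.univ (Hankel.w K m m q) 1) = 0 ∨ finrank K (Kr K Finset.univ (Hankel.w K m m q) 1) = m ∨
      finrank K (Kr K Finset.univ (Hankel.w K m m q) 1) = m + m := by
  by_cases h : Kr K Finset.univ (Hankel.w K m m q) 1 = ⊥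
  · left; rw [h, finrank_bot]
  · by_cases hw : Hankel.w K m m q = 0
    · right; right
      rw [hw, Kr_zero_eq_Hom, finrank_Hom_univ, Nat.choose_one_right]
    · right; left
      rw [finrank_Kr_w_of_degenerate K m hm h hw le_rfl, Nat.choose_one_right, Nat.choose_one_right, Nat.add_sub_cancel]

/-- and conversely every listed value occurs: the pure class of slope `λ` has `dim Kr¹ = m` (C6), a non-pure class `0` (C3), the zero class `2m`.
Stated for the record: **`Kr(univ, w_m(q), 1) = 0 ∨ dim = m ∨ w_m(q) = 0`**. -/
theorem Kr_w_one_cases (hm : 1 ≤ m) (q : ℕ → K) :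
    Kr K Finset.univ (Hankel.w K m m q) 1 = ⊥ ∨ finrank K (Kr K Finset.univ (Hankel.w K m m q) 1) = m ∨ Hankel.w K m m q = 0 := by
  by_cases h : Kr K Finset.univ (Hankel.w K m m q) 1 = ⊥
  · exact Or.inl h
  · by_cases hw : Hankel.w K m m q = 0
    · exact Or.inr (Or.inr hw)
    · right; left
      rw [finrank_Kr_w_of_degenerate K m hm h hw le_rfl, Nat.choose_one_right, Nat.choose_one_right, Nat.add_sub_cancel]

end Summit.Ventures.HSemireg.Wedge.HankelRankOne
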